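import Summits.HodgeConjecture.HodgeCM.CM.LefschetzChar_1

/-! PORT of `HodgeCM/CM/LefschetzChar.lean` (HodgeCMPerL run 82) — part 2: continuation of `Summits.HodgeConjecture.HodgeCM.CM.LefschetzChar_1` (split at a top-level declaration boundary by port_pkg.py; scope re-opened below; declarations unchanged). -/

-- port_pkg: scope re-opened for this part (file-level context, then the namespace/section stack open at the cut)
noncomputable section
open NumberField NumberField.ComplexEmbedding
open scoped symmDiff
namespace HodgeCM
open Literature.AlgebraicGeometry.Motives (CMType)
open CMTypeOps
open HodgeCM.Prior.AllgGroup.RfwfAllgGroup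
section Main
variable {F : Type} [Field F] [NumberField F]
attribute [local instance] Classical.propDecidable
variable [IsGalois ℚ F]
omit [IsGalois ℚ F] in
/-- (Ported verbatim from the HodgeCMPerL package; no docstring in the source.) -/
theorem oflipCM_barCM (t : GalT F) (Ψ : CMF (GalT F) conjT) :
    oflipCM conjT conjT_mul_self t (barCM Ψ) = barCM (oflipCM conjT conjT_mul_self t Ψ) := by
  apply Subtype.ext
  ext x
  change x ∈ (barCM Ψ).1 ∆ orb conjT t ↔ x ∈ (barCM (oflipCM conjT conjT_mul_self t Ψ)).1
  rw [mem_barCM, Finset.mem_symmDiff, mem_barCM]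
  change _ ↔ x ∉ Ψ.1 ∆ orb conjT t
  rw [Finset.mem_symmDiff]
  tauto

/-- The geometric face attached to a group-level face datum `(Φ'; t, t')` and a base point `σ₀`. -/
def faceOfG (σ₀ : F →+* ℂ) (Φ' : CMF (GalT F) conjT) (t t' : GalT F) (ht' : t' ∉ orb conjT t) : Face F where
  Φ := pushType σ₀ Φ'
  p := t.1 σ₀
  p' := t'.1 σ₀
  place_ne := by
    intro h
    rw [InfinitePlace.mk_eq_iff] at h
    apply ht'
    rw [mem_orb]
    rcases h with h | h
    · exact Or.inl (GalT.ext_of_apply σ₀ h).symm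
    · refine Or.inr (GalT.ext_of_apply σ₀ ?_)
      simpa using h.symm

/-- **Dictionary**: the Lefschetz character of the `σ₀`-Weil weight on the corners
`(Φ, Φ̄^{(π)}, Φ̄^{(π′)}, Φ^{(ππ′)})` of the face is `ā` of the face relation
`[Φ] + [Φ^{(ππ′)}] − [Φ^{(π)}] − [Φ^{(π′)}]` (the two conjugated corners contribute with a MINUS sign:
"ā kills pairs" = the ā-bridge of [QW8] §3 at the combinatorial level). -/
theorem lefChar_corner_faceOfG (σ₀ : F →+* ℂ) (Φ' : CMF (GalT F) conjT) (t t' : GalT F)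
    (ht' : t' ∉ orb conjT t) :
    lefChar (faceOfG σ₀ Φ' t t' ht').corner (fun _ => {σ₀}) =
      abar (gface conjT conjT_mul_self Φ' t t') := by
  unfold lefChar
  rw [Fin.sum_univ_four]
  simp only [Finset.sum_singleton]
  change achar (pullType (pushType σ₀ Φ') σ₀) +
      achar (pullType (flip (t.1 σ₀) (bar (pushType σ₀ Φ'))) σ₀) +
      achar (pullType (flip (t'.1 σ₀) (bar (pushType σ₀ Φ'))) σ₀) +
      achar (pullType (flip (t'.1 σ₀) (flip (t.1 σ₀) (pushType σ₀ Φ'))) σ₀) = _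
  simp only [pullType_flip, pullType_bar, pullType_pushType, oflipCM_barCM, achar_bar]
  rw [oflipCM_comm t' t, gface, map_sub, map_sub, map_add]
  simp only [achar]
  abel

/-- **Main combinatorial theorem** (COR-CM (a)+(b4)+row 9, all `g`): for a Galois CM field `F` and a
Hodge weight `S` on `∏_j A_{(F,Θ_j)}`, the Lefschetz character `a(e_S)` is an integer combination of
the Lefschetz characters of `σ₀`-Weil weights on corner products of rank-four faces of `F`. -/
theorem lefChar_eq_sum_faces [IsTotallyComplex F] {n : ℕ} (Θ : Fin (n + 1) → CMType F) {p : ℕ}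
    (S : Fin (n + 1) → Finset (F →+* ℂ)) (hS : IsHodgeWeight Θ p S) (σ₀ : F →+* ℂ) :
    ∃ (m : ℕ) (f : Fin m → Face F) (c : Fin m → ℤ),
      lefChar Θ S = ∑ i, c i • lefChar (f i).corner (fun _ => {σ₀}) := by
  obtain ⟨m, c, y, h⟩ := lefChar_eq_sum_gface Θ S hS
  have hy : ∀ i, ∃ (Φ' : CMF (GalT F) conjT) (t t' : GalT F) (ht' : t' ∉ orb conjT t),
      (y i).1 = gface conjT conjT_mul_self Φ' t t' := by
    intro i
    obtain ⟨Φ', t, t', ht', e⟩ := (y i).2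
    exact ⟨Φ', t, t', ht', e⟩
  choose Φ' t t' ht' hy using hy
  refine ⟨m, fun i => faceOfG σ₀ (Φ' i) (t i) (t' i) (ht' i), c, ?_⟩
  rw [h]
  refine Finset.sum_congr rfl fun i _ => ?_
  rw [lefChar_corner_faceOfG, hy]

end Main

end HodgeCM

end
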